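import Literature.Geometry.Riemannian.HopfRinowCompact
import Literature.Geometry.Lorentzian.TwoParameterMaps
import HarnessLib

/-!
# The Gauss lemma (Lee 2018, Thm. 6.9), bilinear form: `g(d(exp_y)_v v, d(exp_y)_v ξ) = g_y(v, ξ)`

Fourth step towards the named fact `hopfRinow_compact` of `ExponentialMap.lean` (sibling of the
tree's `GaussLemma.lean`, which proves the radial-isometry form — radial part and orthogonal
part separately — for `exp_y` smooth on a tube around the segment, without completeness; here
the single bilinear identity, for `exp_y` merely `C²` on an open set containing the segment
`[0, 1] v`, on a geodesically complete connection, which is the form consumed by the radial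
length inequality of `GeodesicBallMinimizing.lean`). For a `C^n`
pseudo-Riemannian metric `g` (`1 ≤ n`) on a Hausdorff manifold without boundary whose Levi-Civita
connection is `C¹` and geodesically complete, a point `y`, and an open set `V ⊆ T_yM = E` on which
the exponential map `exp_y : E → M` is `C²`, we prove **the Gauss lemma** in the invariant form

  `g_{exp_y v}(d(exp_y)_v(v), d(exp_y)_v(ξ)) = g_y(v, ξ)`   (`val_mfderiv_riemannianExpMap`)

for all `ξ ∈ T_yM` and all `v` whose segment `{t v : 0 ≤ t ≤ 1}` lies in `V` (Lee 2018, Thm. 6.9,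
"the radial vector field is a unit vector field orthogonal to the geodesic spheres", there stated
inside a geodesic ball for Riemannian `g`; the identity above is its content `⟨W, ∂_r⟩ = 0` for
`W = d(exp_y)_v(ξ)`, `ξ ⊥ v`, together with `|∂_r| = 1`, and needs neither positivity nor a normal
neighbourhood; smoothness of `exp_y` near `0` is Prop. 5.19 (c)). The proof is Lee's
(pp. 158–159), with the variation through radial geodesics `Γ(s, t) = exp_y(t (v + s ξ))`,
`T = ∂_t Γ`, `S = ∂_s Γ`:
`∂_t ⟨S, T⟩ = ⟨D_t S, T⟩ + ⟨S, D_t T⟩ = ⟨D_s T, T⟩ = ½ ∂_s ⟨T, T⟩ = ½ ∂_s |v + s ξ|² = ⟨v, ξ⟩`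
at `s = 0` (compatibility `hasDerivAt_val_apply_along`, the geodesic equation, the symmetry lemma
`covariantDerivAlong_velocity_comm` of `TwoParameterMaps.lean`, constant speed), and
`⟨S, T⟩ = 0` at `t = 0` since `S(s, 0) = 0`; at `t = 1`, `S = d(exp_y)_v(ξ)` and
`T = d(exp_y)_v(v)`.

No definitions, no named facts (D-0026).

## References

* J. M. Lee, *Introduction to Riemannian Manifolds*, 2nd ed., GTM 176 (2018): Lemma 6.2,
  Thm. 6.9, Cor. 6.10 (pp. 152–159). [LeeRiemannianManifolds2018]
* B. O'Neill, *Semi-Riemannian geometry* (1983), Ch. 5, Lemma 1 (Gauss lemma). [ONeill1983]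
-/

noncomputable section

open Bundle Set Filter Function Manifold
open scoped Manifold ContDiff Topology

namespace Literature.Geometry.Riemannian

open Literature.Geometry.Lorentzian
open Literature.Geometry.Lorentzian.PseudoRiemannianMetric

variable {E : Type*} [NormedAddCommGroup E] [NormedSpace ℝ E] {H : Type*} [TopologicalSpace H]
  {I : ModelWithCorners ℝ E H} {M : Type*} [TopologicalSpace M] [ChartedSpace H M]
  [IsManifold I ∞ M] {n : ℕ∞ω} [FiniteDimensional ℝ E] [CompleteSpace E] [T2Space M]
  [BoundarylessManifold I M]
  {g : PseudoRiemannianMetric I n E (TangentSpace I : M → Type _)} [g.HasLeviCivita]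
  [CovariantDerivative.ContMDiffCovariantDerivative g.leviCivita 1]

omit [CompleteSpace E] [T2Space M] [BoundarylessManifold I M]
  [CovariantDerivative.ContMDiffCovariantDerivative g.leviCivita 1] in
/-- **The variation through radial geodesics** `x t s = exp_y(t (v + s ξ))` is a `C²`
two-parameter map at `(t, s)` whenever `exp_y` is `C²` on an open set containing `t (v + s ξ)`
(composition with a polynomial map `ℝ × ℝ → E`). Lee 2018, proof of Thm. 6.9 (the map `Γ(s,t)`).
[cite: LeeRiemannianManifolds2018, Thm. 6.9 (proof)] -/
theorem contMDiffAt_uncurry_radialVariation (y : M) {V : Set E} (hV : IsOpen V)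
    (hsmooth : ContMDiffOn 𝓘(ℝ, E) I 2
      (fun w : E => riemannianExpMap g y (show TangentSpace I y from w)) V)
    (v ξ : E) {t s : ℝ} (hts : t • (v + s • ξ) ∈ V) :
    ContMDiffAt (𝓘(ℝ, ℝ).prod 𝓘(ℝ, ℝ)) I 2
      (uncurry fun t s : ℝ => riemannianExpMap g y (show TangentSpace I y from t • (v + s • ξ)))
      (t, s) := by
  have hexp : ContMDiffAt 𝓘(ℝ, E) I 2 (fun w : E => riemannianExpMap g y (show TangentSpace I y from w))
      (t • (v + s • ξ)) := hsmooth.contMDiffAt (hV.mem_nhds hts)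
  have hpoly : ContMDiff (𝓘(ℝ, ℝ).prod 𝓘(ℝ, ℝ)) 𝓘(ℝ, E) 2
      (fun q : ℝ × ℝ => q.1 • (v + q.2 • ξ)) := by
    have h : ContMDiff 𝓘(ℝ, ℝ × ℝ) 𝓘(ℝ, E) 2 (fun q : ℝ × ℝ => q.1 • (v + q.2 • ξ)) :=
      contMDiff_iff_contDiff.2
        (contDiff_fst.smul (contDiff_const.add (contDiff_snd.smul contDiff_const)))
    rw [modelWithCornersSelf_prod, ← chartedSpaceSelf_prod] at h
    exact h
  have h := hexp.comp (t, s) (hpoly (t, s))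
  exact h

/-- The `t`-curves of the radial variation are the geodesics `γ_{v + s ξ}`:
`exp_y(t (v + s ξ)) = γ_{v + s ξ}(t)` (Lee, Prop. 5.19 (b)). [cite: LeeRiemannianManifolds2018, Prop. 5.19 (b)] -/
theorem radialVariation_eq_maximalGeodesic (hc : IsGeodesicallyComplete g.leviCivita) (y : M)
    (v ξ : E) (s : ℝ) :
    (fun t : ℝ => riemannianExpMap g y (show TangentSpace I y from t • (v + s • ξ))) =
      maximalGeodesic g.leviCivita y (show TangentSpace I y from v + s • ξ) :=
  funext fun t => expMap_smul hc y (show TangentSpace I y from v + s • ξ) t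

/-- **The Gauss lemma** (Lee 2018, Thm. 6.9; O'Neill 1983, Ch. 5, Lemma 1), invariant form:
for a smooth metric with geodesically complete Levi-Civita connection, all `y` and all
`v, ξ ∈ T_yM = E`,
`g_{exp_y v}(d(exp_y)_v(v), d(exp_y)_v(ξ)) = g_y(v, ξ)`, where `d(exp_y)_v` is the manifold
derivative `mfderiv` of `exp_y : E → M` at `v`. Proof (Lee, pp. 158–159): along the radial
variation `x t s = exp_y(t(v + sξ))` one has `∂_t g(S, T) = g(D_t S, T)` (compatibility and the
geodesic equation `D_t T = 0`), `D_t S = D_s T` (symmetry lemma), `2 g(D_s T, T) = ∂_s g(T, T) =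
∂_s g_y(v + sξ, v + sξ)` (compatibility and constant speed), which is `2 g_y(v, ξ)` at `s = 0`; so
`t ↦ g(S, T)(t, 0) - t g_y(v, ξ)` is constant, `= 0` at `t = 0` (`S(0, 0) = 0`), and at `t = 1`
the fields are `S = d(exp_y)_v(ξ)`, `T = d(exp_y)_v(v)`.
[cite: LeeRiemannianManifolds2018, Thm. 6.9] -/
theorem val_mfderiv_riemannianExpMap [Fact (1 ≤ n)] (hc : IsGeodesicallyComplete g.leviCivita)
    (y : M) {V : Set E} (hV : IsOpen V)
    (hsmooth : ContMDiffOn 𝓘(ℝ, E) I 2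
      (fun w : E => riemannianExpMap g y (show TangentSpace I y from w)) V)
    {v : E} (hv : ∀ t ∈ Icc (0 : ℝ) 1, t • v ∈ V) (ξ : E) :
    g.val (riemannianExpMap g y (show TangentSpace I y from v))
      (mfderiv 𝓘(ℝ, E) I (fun w : E => riemannianExpMap g y (show TangentSpace I y from w)) v v)
      (mfderiv 𝓘(ℝ, E) I (fun w : E => riemannianExpMap g y (show TangentSpace I y from w)) v ξ) =
    g.val y (show TangentSpace I y from v) (show TangentSpace I y from ξ) := by
  -- the vectors read in `T_yM`, the variation and its regularity at `s = 0`
  set vT : TangentSpace I y := (show TangentSpace I y from v) with hvT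
  set ξT : TangentSpace I y := (show TangentSpace I y from ξ) with hξT
  set x : ℝ → ℝ → M := fun t s => riemannianExpMap g y (t • (vT + s • ξT)) with hx_def
  have hv1 : v ∈ V := by simpa using hv 1 ⟨zero_le_one, le_rfl⟩
  have hx2 : ∀ t ∈ Icc (0 : ℝ) 1, ContMDiffAt (𝓘(ℝ, ℝ).prod 𝓘(ℝ, ℝ)) I 2 (uncurry x) (t, 0) :=
    fun t ht => contMDiffAt_uncurry_radialVariation y hV hsmooth v ξ
      (by rw [zero_smul, add_zero]; exact hv t ht)
  have hgeo : ∀ s : ℝ, (fun t => x t s) = maximalGeodesic g.leviCivita y (vT + s • ξT) :=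
    fun s => funext fun t => expMap_smul hc y (vT + s • ξT) t
  have hLC := isLeviCivita_leviCivita_holds (g := g)
  have htors : g.leviCivita.torsion = 0 := hLC.1
  have hcompat : g.IsCompatible g.leviCivita := hLC.2
  -- the fields `S(t) = x_s(t, 0)` and `T(t) = x_t(t, 0)` along `t ↦ x t 0`, and `f = g(S, T)`
  -- Step 1: `∂_t g(S, T) = g(D_s T, T)` at `s = 0`
  have hstep1 : ∀ t ∈ Icc (0 : ℝ) 1, HasDerivAt (fun t => g.val (x t 0) (velocity I (x t) 0)
      (velocity I (fun t' => x t' 0) t))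
      (g.val (x t 0) (covariantDerivAlong g.leviCivita (x t)
        (fun s => velocity I (fun t' => x t' s) t) 0) (velocity I (fun t' => x t' 0) t)) t := by
    intro t ht
    have hV := mdifferentiableAt_lift_velocity_curry_right (hx2 t ht)
    obtain ⟨-, hγ, -, -⟩ := maximalGeodesic_of_isGeodesicallyComplete hc y (vT + (0 : ℝ) • ξT)
    have hW : MDifferentiableAt 𝓘(ℝ, ℝ) I.tangent
        (fun t => (TotalSpace.mk' E (x t 0) (velocity I (fun t' => x t' 0) t) : TangentBundle I M))
        t := by
      have h := hγ.1 t (mem_univ t)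
      rw [← hgeo 0] at h
      exact h
    have hDT : covariantDerivAlong g.leviCivita (fun t' => x t' 0)
        (fun t => velocity I (fun t' => x t' 0) t) t = 0 := by
      have h := hγ.2 t (mem_univ t)
      rw [← hgeo 0] at h
      exact h
    have h := g.hasDerivAt_val_apply_along hcompat hV hW
    rw [hDT, map_zero, add_zero, covariantDerivAlong_velocity_comm g.leviCivita htors (hx2 t ht)] at h
    exact h
  -- Step 2: `2 g(D_s T, T) = ∂_s g(T, T) = 2 g_y(v, ξ)` at `s = 0`
  have hstep2 : ∀ t ∈ Icc (0 : ℝ) 1, g.val (x t 0) (covariantDerivAlong g.leviCivita (x t)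
      (fun s => velocity I (fun t' => x t' s) t) 0) (velocity I (fun t' => x t' 0) t) =
      g.val y vT ξT := by
    intro t ht
    -- the field `s ↦ T(t, s)` along the `s`-curve `s ↦ x t s`, differentiable at `s = 0`
    have hT : MDifferentiableAt 𝓘(ℝ, ℝ) I.tangent
        (fun s => (TotalSpace.mk' E (x t s) (velocity I (fun t' => x t' s) t) : TangentBundle I M))
        0 := mdifferentiableAt_lift_velocity_curry_left (hx2 t ht)
    have h1 := g.hasDerivAt_val_apply_along hcompat hT hT
    -- `g(T, T)(t, s) = g_y(v + sξ, v + sξ)` (constant speed), a quadratic polynomial in `s`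
    have hspeed : ∀ s : ℝ, g.val (x t s) (velocity I (fun t' => x t' s) t)
        (velocity I (fun t' => x t' s) t) =
        g.val y vT vT + (2 * g.val y vT ξT * s + g.val y ξT ξT * s ^ 2) := by
      intro s
      have h := val_velocity_maximalGeodesic hc y (vT + s • ξT) t
      rw [← hgeo s] at h
      rw [h]
      simp only [map_add, map_smul]
      rw [_root_.add_apply, _root_.add_apply, _root_.smul_apply, _root_.smul_apply, g.symm y ξT vT,
        smul_eq_mul, smul_eq_mul]
      ring
    have hfun : (fun s : ℝ => g.val (x t s) (velocity I (fun t' => x t' s) t)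
        (velocity I (fun t' => x t' s) t)) =
        fun s : ℝ => g.val y vT vT + (2 * g.val y vT ξT * s + g.val y ξT ξT * s ^ 2) :=
      funext hspeed
    have hd1 : HasDerivAt (fun s : ℝ => 2 * g.val y vT ξT * s) (2 * g.val y vT ξT) 0 := by
      simpa using (hasDerivAt_id (0 : ℝ)).const_mul (2 * g.val y vT ξT)
    have hd2 : HasDerivAt (fun s : ℝ => g.val y ξT ξT * s ^ 2) 0 0 := by
      simpa using ((hasDerivAt_id (0 : ℝ)).pow 2).const_mul (g.val y ξT ξT)
    have hd : HasDerivAt (fun s : ℝ => g.val y vT vT + (2 * g.val y vT ξT * s + g.val y ξT ξT * s ^ 2))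
        (2 * g.val y vT ξT) 0 := by
      simpa using (hd1.add hd2).const_add (g.val y vT vT)
    have h2 : HasDerivAt (fun s : ℝ => g.val (x t s) (velocity I (fun t' => x t' s) t)
        (velocity I (fun t' => x t' s) t)) (2 * g.val y vT ξT) 0 := by
      rw [hfun]
      exact hd
    have h3 := h1.unique h2
    rw [g.symm (x t 0) (velocity I (fun t' => x t' 0) t)] at h3
    linarith
  -- Step 3: `f(t) = g(S, T)(t, 0)` has constant derivative `g_y(v, ξ)` and `f(0) = 0`
  set f : ℝ → ℝ := fun t => g.val (x t 0) (velocity I (x t) 0) (velocity I (fun t' => x t' 0) t)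
    with hf_def
  have hfd : ∀ t ∈ Icc (0 : ℝ) 1, HasDerivAt f (g.val y vT ξT) t := fun t ht => by
    have h := hstep1 t ht
    rw [hstep2 t ht] at h
    exact h
  have hf0 : f 0 = 0 := by
    have hconst : x 0 = fun _ => y := by
      funext s
      show riemannianExpMap g y ((0 : ℝ) • (vT + s • ξT)) = y
      rw [zero_smul, riemannianExpMap_zero]
    have hS0 : velocity I (x 0) 0 = 0 := by
      rw [hconst]
      exact velocity_const y 0
    show g.val (x 0 0) (velocity I (x 0) 0) (velocity I (fun t' => x t' 0) 0) = 0
    rw [hS0, map_zero]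
    rfl
  have hf1 : f 1 = g.val y vT ξT := by
    have hF : ∀ t ∈ Icc (0 : ℝ) 1, HasDerivAt (fun t => f t - g.val y vT ξT * t) 0 t :=
      fun t ht => by
        have h := (hfd t ht).sub ((hasDerivAt_id t).const_mul (g.val y vT ξT))
        simp only [mul_one, sub_self] at h
        exact h
    have hcont : ContinuousOn (fun t => f t - g.val y vT ξT * t) (Icc 0 1) :=
      fun t ht => (hF t ht).continuousAt.continuousWithinAt
    have hconst := constant_of_has_deriv_right_zero hcont
      (fun t ht => ((hF t (Ico_subset_Icc_self ht)).hasDerivWithinAt)) 1 ⟨zero_le_one, le_rfl⟩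
    simp only [hf0, mul_one, mul_zero, sub_zero] at hconst
    linarith
  -- Step 4: at `t = 1`: `S = d(exp_y)_v ξ`, `T = d(exp_y)_v v`
  have hexpd : ∀ p ∈ V, HasMFDerivAt 𝓘(ℝ, E) I
      (fun w : E => riemannianExpMap g y (show TangentSpace I y from w)) p
      (mfderiv 𝓘(ℝ, E) I (fun w : E => riemannianExpMap g y (show TangentSpace I y from w)) p) :=
    fun p hp => ((hsmooth.contMDiffAt (hV.mem_nhds hp)).mdifferentiableAt two_ne_zero).hasMFDerivAt
  have hS1 : velocity I (x 1) 0 =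
      mfderiv 𝓘(ℝ, E) I (fun w : E => riemannianExpMap g y (show TangentSpace I y from w)) v ξ := by
    -- `x 1 = exp_y ∘ (s ↦ 1 • (v + s • ξ))`
    have hc' : HasMFDerivAt 𝓘(ℝ, ℝ) 𝓘(ℝ, E) (fun s : ℝ => (1 : ℝ) • (v + s • ξ)) 0
        ((1 : ℝ →L[ℝ] ℝ).smulRight ((1 : ℝ) • ((1 : ℝ) • ξ))) :=
      hasMFDerivAt_iff_hasFDerivAt.2
        ((((hasDerivAt_id (0 : ℝ)).smul_const ξ).const_add v).const_smul (1 : ℝ)).hasFDerivAt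
    have hp : (fun s : ℝ => (1 : ℝ) • (v + s • ξ)) 0 = v := by simp
    have hev : HasMFDerivAt 𝓘(ℝ, E) I
        (fun w : E => riemannianExpMap g y (show TangentSpace I y from w))
        ((fun s : ℝ => (1 : ℝ) • (v + s • ξ)) 0)
        (mfderiv 𝓘(ℝ, E) I (fun w : E => riemannianExpMap g y (show TangentSpace I y from w)) v) := by
      rw [hp]
      exact hexpd v hv1
    have h := (hev.comp 0 hc').mfderiv
    show mfderiv 𝓘(ℝ, ℝ) I (x 1) 0 1 = _
    rw [show x 1 = (fun w : E => riemannianExpMap g y (show TangentSpace I y from w)) ∘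
      (fun s : ℝ => (1 : ℝ) • (v + s • ξ)) from rfl, h]
    show mfderiv 𝓘(ℝ, E) I (fun w : E => riemannianExpMap g y (show TangentSpace I y from w)) v
      (((1 : ℝ →L[ℝ] ℝ) (1 : ℝ)) • ((1 : ℝ) • ((1 : ℝ) • ξ))) = _
    rw [one_apply_eq_self, one_smul, one_smul, one_smul]
  have hT1 : velocity I (fun t' => x t' 0) 1 =
      mfderiv 𝓘(ℝ, E) I (fun w : E => riemannianExpMap g y (show TangentSpace I y from w)) v v := by
    have hc' : HasMFDerivAt 𝓘(ℝ, ℝ) 𝓘(ℝ, E) (fun t : ℝ => t • (v + (0 : ℝ) • ξ)) 1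
        ((1 : ℝ →L[ℝ] ℝ).smulRight ((1 : ℝ) • (v + (0 : ℝ) • ξ))) :=
      hasMFDerivAt_iff_hasFDerivAt.2 ((hasDerivAt_id (1 : ℝ)).smul_const (v + (0 : ℝ) • ξ)).hasFDerivAt
    have hp : (fun t : ℝ => t • (v + (0 : ℝ) • ξ)) 1 = v := by simp
    have hev : HasMFDerivAt 𝓘(ℝ, E) I
        (fun w : E => riemannianExpMap g y (show TangentSpace I y from w))
        ((fun t : ℝ => t • (v + (0 : ℝ) • ξ)) 1)
        (mfderiv 𝓘(ℝ, E) I (fun w : E => riemannianExpMap g y (show TangentSpace I y from w)) v) := by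
      rw [hp]
      exact hexpd v hv1
    have h := (hev.comp 1 hc').mfderiv
    show mfderiv 𝓘(ℝ, ℝ) I (fun t' => x t' 0) 1 1 = _
    rw [show (fun t' => x t' 0) = (fun w : E => riemannianExpMap g y (show TangentSpace I y from w)) ∘
      (fun t : ℝ => t • (v + (0 : ℝ) • ξ)) from rfl, h]
    show mfderiv 𝓘(ℝ, E) I (fun w : E => riemannianExpMap g y (show TangentSpace I y from w)) v
      (((1 : ℝ →L[ℝ] ℝ) (1 : ℝ)) • ((1 : ℝ) • (v + (0 : ℝ) • ξ))) = _
    rw [one_apply_eq_self, one_smul, one_smul, zero_smul, add_zero]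
  have hx10 : x 1 0 = riemannianExpMap g y vT := by
    show riemannianExpMap g y ((1 : ℝ) • (vT + (0 : ℝ) • ξT)) = _
    rw [one_smul, zero_smul, add_zero]
  -- conclusion
  have key : f 1 = g.val (x 1 0) (velocity I (fun t' => x t' 0) 1) (velocity I (x 1) 0) := by
    show g.val (x 1 0) (velocity I (x 1) 0) (velocity I (fun t' => x t' 0) 1) = _
    exact g.symm _ _ _
  rw [hf1, hS1, hT1] at key
  show _ = g.val y vT ξT
  rw [key]
  have gen : ∀ (p : M) (hp : x 1 0 = p), g.val (x 1 0)
      (mfderiv 𝓘(ℝ, E) I (fun w : E => riemannianExpMap g y (show TangentSpace I y from w)) v v)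
      (mfderiv 𝓘(ℝ, E) I (fun w : E => riemannianExpMap g y (show TangentSpace I y from w)) v ξ) =
      g.val p
      (mfderiv 𝓘(ℝ, E) I (fun w : E => riemannianExpMap g y (show TangentSpace I y from w)) v v)
      (mfderiv 𝓘(ℝ, E) I (fun w : E => riemannianExpMap g y (show TangentSpace I y from w)) v ξ) := by
    intro p hp
    subst hp
    rfl
  exact (gen _ hx10).symm

end Literature.Geometry.Riemannian
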